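import Summits.AtomisticToContinuum.Crystallization.Theorems.OverbindingBudgetAffineRunCutFarCone
import Literature.MathematicalPhysics.StatisticalMechanics.Crystallization

/-!
# `OverbindingBudget` / crux `RobustDefectLimitWindows` (stmt-AtomisticToContinuum-31280) — «RunCut»: the lattice beyond the near ball, FORGONE AT A CERTIFIED PRICE

Support file (lens-4 g86, hand-in 2 file 6 for the competitor leaf **SW♭** `StackSwapGainFlat(Wide)`; memo `g86/memo/SW-G1.md` §0.5, §3).
The certified IDEAL gain of the TRIPLE column is the FULL-lattice gain (`…RunCutColumnGain.triple_column_gain`); the certificate may only use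
lattice structure inside the near ball (radius `22a`) and treats everything beyond as «far matter» (`…RunCutFarCone`).  The difference — the
lattice beyond the ball — is bounded here WITHOUT any ball kernel sum:

* §1 ALGEBRAIC TAYLOR in the squared distance (`8|t| ≤ P`): `|(P+t)⁻³ − P⁻³ + 3tP⁻⁴ − 6t²P⁻⁵| ≤ 18|t|³P⁻⁶` (`inv_pow_three_taylor3`, third
  order) and `|(P+t)⁻⁶ − P⁻⁶ + 6tP⁻⁷| ≤ 72t²P⁻⁸` (`inv_pow_six_taylor2`; the kit's `HcpFccLatticeSumsSecondDiff` identities with the hypothesis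
  relaxed from `30|t| ≤ P` / `25|t| ≤ 2P` to `8|t| ≤ P`, which is what a slip `|t| ≤ 1.16a` at range `22a` needs);
* §2 THE α-AVERAGE: `V(‖x − t‖) = ljSq(‖x‖² + ε)`, `ε = ‖t‖² − 2⟨x,t⟩`; for three slips `t_α` with `∑ t_α = 0`, `‖t_α‖² = σ` the first order
  cancels exactly (`∑ ε_α = 3σ`) and `∑ ε_α² = 3σ² + 4∑⟨x,t_α⟩²` with the 120°-frame Bessel inequality `∑_α ⟨x,t_α⟩² ≤ (3/2)σ‖x‖²`
  (`inner_sq_sum_le`, by the explicit projection residual `‖3σ·x − (4e₁+2e₂)t₁ − (2e₁+4e₂)t₂‖² = 9σ²‖x‖² − 12σ(e₁² + e₁e₂ + e₂²) ≥ 0`);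
  ⇒ ★ `avg_lennardJones_sub_le`: `‖x‖² ≥ 300`, `289σ ≤ ‖x‖²` ⇒ `|⅓∑_α V(‖x − t_α‖) − V(‖x‖)| ≤ (23/10)·σ·‖x‖⁻⁸` (constant: `9/4` from the
  main term `σu⁴(−3 + 12 sin²)/6`-type bookkeeping + `1/289`-, `300⁻³`-size corrections; `V = lennardJones = r⁻¹²/12 − r⁻⁶/6`);
* §4 SUMMED with D1's own packing lemma over the `a`-separated partners beyond `22a` (`…FarCone.sum_inv_pow_eight_far_le_of_le_21`, `n₀ = 22`,
  `s = a`): ★ `forgone_far_sum_le`: `∑_{q} |⅓∑_α V(‖q − p − t_α‖) − V(‖q − p‖)| ≤ (23/10)·σ·(38/5)·a⁻⁸·22⁻⁵ = 3.392·10⁻⁶·σ·a⁻⁸` for `a ≥ 4/5`,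
  `σ ≤ (3/2)a²` — with `σ = a²/3` (mover–site pairs, slips `w_α`): `1.13·10⁻⁶·a⁻⁶` per mover = `3.0·10⁻⁶` at `a = 17/20` (`0.9 %` of the certified
  column gain `3.30·10⁻⁴` per mover, `2.7 %` per column), `5.3·10⁻⁸` per column at `a = 2` (`1.1 %`); `σ = 4a²/3` covers the mover–mover pairs
  (relative slips `±2w_α`).  The same §1–§2 lemmas are the second-order input of S4 (roughness) in hand-in 3.
[this file: 1 definition (`ljSq`) + 8 theorems; standard axioms]
-/

noncomputable section

namespace Summit.AtomisticToContinuum.Crystallization.Theorems.OverbindingBudgetAffineRunCutForgone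

open Finset
open Literature.MathematicalPhysics.StatisticalMechanics (lennardJones)

-- (landing lane, hand-2 g40, critic rows 1535/1540 precedent (FarCone v2): the file-local `notation "E3"` replaced by the tree abbreviation of the same name)
open Summit.AtomisticToContinuum.Crystallization.Theorems.ChargedEnergyGapNegative (E3)

/-! ## §1. Algebraic Taylor remainders of `P ↦ P⁻³` (third order) and `P ↦ P⁻⁶` (second order), `8|t| ≤ P` -/

/-- Third-order remainder of `x⁻³`: `|(P+t)⁻³ − P⁻³ + 3tP⁻⁴ − 6t²P⁻⁵| ≤ 18|t|³P⁻⁶` for `8|t| ≤ P` (exact identity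
`(P+t)⁻³ − P⁻³ + 3tP⁻⁴ − 6t²P⁻⁵ = −t³(10P² + 15Pt + 6t²)/(P⁵(P+t)³)`, `|10P²+15Pt+6t²| ≤ 12P²`, `(P+t)³ ≥ (7P/8)³`). [folklore] -/
theorem inv_pow_three_taylor3 {P t : ℝ} (hP : 0 < P) (ht : 8 * |t| ≤ P) :
    |((P + t)⁻¹) ^ 3 - (P⁻¹) ^ 3 + 3 * t * (P⁻¹) ^ 4 - 6 * t ^ 2 * (P⁻¹) ^ 5| ≤ 18 * |t| ^ 3 * (P⁻¹) ^ 6 := by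
  have ht1 : -(P / 8) ≤ t := by linarith [neg_abs_le t]
  have ht2 : t ≤ P / 8 := by linarith [le_abs_self t]
  have hPt : 0 < P + t := by linarith
  have key : ((P + t)⁻¹) ^ 3 - (P⁻¹) ^ 3 + 3 * t * (P⁻¹) ^ 4 - 6 * t ^ 2 * (P⁻¹) ^ 5 =
      -(t ^ 3 * (10 * P ^ 2 + 15 * P * t + 6 * t ^ 2)) / (P ^ 5 * (P + t) ^ 3) := by
    field_simp
    ring
  have hden : 0 < P ^ 5 * (P + t) ^ 3 := by positivity
  have hA : |10 * P ^ 2 + 15 * P * t + 6 * t ^ 2| ≤ 12 * P ^ 2 := by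
    have m1 : P * t ≤ P * (P / 8) := mul_le_mul_of_nonneg_left ht2 hP.le
    have m1' : P * (-(P / 8)) ≤ P * t := mul_le_mul_of_nonneg_left ht1 hP.le
    have m2 : t ^ 2 ≤ (P / 8) ^ 2 := sq_le_sq' ht1 ht2
    rw [abs_le]; constructor <;> nlinarith [sq_nonneg t]
  have hD : P ^ 5 * (7 / 8 * P) ^ 3 ≤ P ^ 5 * (P + t) ^ 3 :=
    mul_le_mul_of_nonneg_left (pow_le_pow_left₀ (by positivity) (by linarith) 3) (by positivity)
  rw [key, abs_div, abs_neg, abs_mul, abs_pow, abs_of_pos hden, div_le_iff₀ hden]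
  calc |t| ^ 3 * |10 * P ^ 2 + 15 * P * t + 6 * t ^ 2| ≤ |t| ^ 3 * (12 * P ^ 2) :=
        mul_le_mul_of_nonneg_left hA (by positivity)
    _ ≤ 18 * |t| ^ 3 * (P⁻¹) ^ 6 * (P ^ 5 * (7 / 8 * P) ^ 3) := by
        have e : 18 * |t| ^ 3 * (P⁻¹) ^ 6 * (P ^ 5 * (7 / 8 * P) ^ 3) = 3087 / 256 * (|t| ^ 3 * P ^ 2) := by
          field_simp
          ring
        rw [e]
        nlinarith [show 0 ≤ |t| ^ 3 * P ^ 2 by positivity]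
    _ ≤ 18 * |t| ^ 3 * (P⁻¹) ^ 6 * (P ^ 5 * (P + t) ^ 3) := mul_le_mul_of_nonneg_left hD (by positivity)

/-- Second-order remainder of `x⁻⁶`: `|(P+t)⁻⁶ − P⁻⁶ + 6tP⁻⁷| ≤ 72 t² P⁻⁸` for `8|t| ≤ P` (the kit's exact identity with numerator
`t²(21P⁵ + 70P⁴t + 105P³t² + 84P²t³ + 35Pt⁴ + 6t⁵)` over `P⁷(P+t)⁶`; `|…| ≤ 32P⁵`, `(P+t)⁶ ≥ (7P/8)⁶`). [folklore] -/
theorem inv_pow_six_taylor2 {P t : ℝ} (hP : 0 < P) (ht : 8 * |t| ≤ P) :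
    |((P + t)⁻¹) ^ 6 - (P⁻¹) ^ 6 + 6 * t * (P⁻¹) ^ 7| ≤ 72 * t ^ 2 * (P⁻¹) ^ 8 := by
  have h8 : |t| ≤ P / 8 := by linarith
  have ht1 : -(P / 8) ≤ t := by linarith [neg_abs_le t]
  have ht2 : t ≤ P / 8 := by linarith [le_abs_self t]
  have hPt : 0 < P + t := by linarith
  have key : ((P + t)⁻¹) ^ 6 - (P⁻¹) ^ 6 + 6 * t * (P⁻¹) ^ 7 =
      t ^ 2 * (21 * P ^ 5 + 70 * P ^ 4 * t + 105 * P ^ 3 * t ^ 2 + 84 * P ^ 2 * t ^ 3 +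
        35 * P * t ^ 4 + 6 * t ^ 5) / (P ^ 7 * (P + t) ^ 6) := by
    field_simp
    ring
  have hden : 0 < P ^ 7 * (P + t) ^ 6 := by positivity
  have hA : |21 * P ^ 5 + 70 * P ^ 4 * t + 105 * P ^ 3 * t ^ 2 + 84 * P ^ 2 * t ^ 3 + 35 * P * t ^ 4 + 6 * t ^ 5|
      ≤ 32 * P ^ 5 := by
    have m2 : t ^ 2 ≤ (P / 8) ^ 2 := sq_le_sq' ht1 ht2
    have m3 := abs_le.1 (show |t ^ 3| ≤ (P / 8) ^ 3 by rw [abs_pow]; exact pow_le_pow_left₀ (abs_nonneg t) h8 3)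
    have m4 : t ^ 4 ≤ (P / 8) ^ 4 := by
      have h := pow_le_pow_left₀ (abs_nonneg t) h8 4
      rwa [Even.pow_abs ⟨2, rfl⟩] at h
    have m5 := abs_le.1 (show |t ^ 5| ≤ (P / 8) ^ 5 by rw [abs_pow]; exact pow_le_pow_left₀ (abs_nonneg t) h8 5)
    have b1 : P ^ 4 * t ≤ P ^ 4 * (P / 8) := mul_le_mul_of_nonneg_left ht2 (by positivity)
    have b1' : P ^ 4 * (-(P / 8)) ≤ P ^ 4 * t := mul_le_mul_of_nonneg_left ht1 (by positivity)
    have b2 : P ^ 3 * t ^ 2 ≤ P ^ 3 * (P / 8) ^ 2 := mul_le_mul_of_nonneg_left m2 (by positivity)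
    have b2' : 0 ≤ P ^ 3 * t ^ 2 := by positivity
    have b3 : P ^ 2 * t ^ 3 ≤ P ^ 2 * (P / 8) ^ 3 := mul_le_mul_of_nonneg_left m3.2 (by positivity)
    have b3' : P ^ 2 * (-((P / 8) ^ 3)) ≤ P ^ 2 * t ^ 3 := mul_le_mul_of_nonneg_left m3.1 (by positivity)
    have b4 : P * t ^ 4 ≤ P * (P / 8) ^ 4 := mul_le_mul_of_nonneg_left m4 hP.le
    have b4' : 0 ≤ P * t ^ 4 := by positivity
    have hP5 : 0 < P ^ 5 := by positivity
    rw [abs_le]; constructor <;> nlinarith [m5.1, m5.2]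
  have hD : P ^ 7 * (7 / 8 * P) ^ 6 ≤ P ^ 7 * (P + t) ^ 6 :=
    mul_le_mul_of_nonneg_left (pow_le_pow_left₀ (by positivity) (by linarith) 6) (by positivity)
  rw [key, abs_div, abs_mul, abs_of_nonneg (sq_nonneg t), abs_of_pos hden, div_le_iff₀ hden]
  calc t ^ 2 * |21 * P ^ 5 + 70 * P ^ 4 * t + 105 * P ^ 3 * t ^ 2 + 84 * P ^ 2 * t ^ 3 + 35 * P * t ^ 4 + 6 * t ^ 5|
        ≤ t ^ 2 * (32 * P ^ 5) := mul_le_mul_of_nonneg_left hA (sq_nonneg t)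
    _ ≤ 72 * t ^ 2 * (P⁻¹) ^ 8 * (P ^ 7 * (7 / 8 * P) ^ 6) := by
        have e : 72 * t ^ 2 * (P⁻¹) ^ 8 * (P ^ 7 * (7 / 8 * P) ^ 6) = 1058841 / 32768 * (t ^ 2 * P ^ 5) := by
          field_simp
          ring
        rw [e]
        nlinarith [show 0 ≤ t ^ 2 * P ^ 5 by positivity]
    _ ≤ 72 * t ^ 2 * (P⁻¹) ^ 8 * (P ^ 7 * (P + t) ^ 6) := mul_le_mul_of_nonneg_left hD (by positivity)

/-! ## §2. The pair potential in the squared distance and the α-averaged second-order bound -/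

/-- The Lennard-Jones potential as a function of the SQUARED distance: `ljSq Q = Q⁻⁶/12 − Q⁻³/6`. [this file · kind: definition] -/
def ljSq (Q : ℝ) : ℝ :=
  1 / 12 * (Q⁻¹) ^ 6 - 1 / 6 * (Q⁻¹) ^ 3

/-- `V_LJ(r) = ljSq (r²)`. [folklore] -/
theorem lennardJones_eq_ljSq (r : ℝ) : lennardJones r = ljSq (r ^ 2) := by
  simp only [lennardJones, ljSq, inv_pow, ← pow_mul]

/-- **Per-displacement sandwich** (`u = P⁻¹`, `8|ε| ≤ P`):
`½εu⁴ − (11/8)ε²u⁵ − ½εu⁷ − 6ε²u⁸ ≤ ljSq(P+ε) − ljSq(P) ≤ ½εu⁴ − (5/8)ε²u⁵ − ½εu⁷ + 6ε²u⁸`. [folklore] -/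
theorem ljSq_sandwich {P ε : ℝ} (hP : 0 < P) (hε : 8 * |ε| ≤ P) :
    1 / 2 * ε * (P⁻¹) ^ 4 - 11 / 8 * ε ^ 2 * (P⁻¹) ^ 5 - 1 / 2 * ε * (P⁻¹) ^ 7 - 6 * ε ^ 2 * (P⁻¹) ^ 8
        ≤ ljSq (P + ε) - ljSq P ∧
      ljSq (P + ε) - ljSq P ≤
        1 / 2 * ε * (P⁻¹) ^ 4 - 5 / 8 * ε ^ 2 * (P⁻¹) ^ 5 - 1 / 2 * ε * (P⁻¹) ^ 7 + 6 * ε ^ 2 * (P⁻¹) ^ 8 := by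
  have h3 := abs_le.1 (inv_pow_three_taylor3 hP hε)
  have h6 := abs_le.1 (inv_pow_six_taylor2 hP hε)
  set u : ℝ := P⁻¹ with hu
  have hu0 : 0 < u := inv_pos.2 hP
  have hPu : P * u = 1 := mul_inv_cancel₀ hP.ne'
  -- `18|ε|³u⁶ ≤ (9/4)ε²u⁵` from `|ε| ≤ P/8`
  have hcub : 18 * |ε| ^ 3 * u ^ 6 ≤ 9 / 4 * ε ^ 2 * u ^ 5 := by
    have h1 : |ε| ^ 3 = |ε| * ε ^ 2 := by rw [pow_succ', sq_abs]
    have h2 : |ε| * u ≤ 1 / 8 := by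
      have := mul_le_mul_of_nonneg_right hε hu0.le
      rw [hPu] at this
      linarith
    have h3' : 0 ≤ ε ^ 2 * u ^ 5 := by positivity
    calc 18 * |ε| ^ 3 * u ^ 6 = 18 * (|ε| * u) * (ε ^ 2 * u ^ 5) := by rw [h1]; ring
      _ ≤ 18 * (1 / 8) * (ε ^ 2 * u ^ 5) := by
          exact mul_le_mul_of_nonneg_right (mul_le_mul_of_nonneg_left h2 (by norm_num)) h3'
      _ = 9 / 4 * ε ^ 2 * u ^ 5 := by ring
  unfold ljSq
  constructor <;> nlinarith [h3.1, h3.2, h6.1, h6.2, hcub]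

/-- **The α-averaged second-order bound, real core**: `P ≥ 300`, `289σ ≤ P`, `σ ≥ 0`, `e₁ + e₂ + e₃ = 0`, `∑ e_α² ≤ (3/2)σP`, `e_α² ≤ Pσ`
⇒ `|⅓∑_α ljSq(P + σ − 2e_α) − ljSq(P)| ≤ (23/10)·σ·P⁻⁴`. [this file · kind: proof] -/
theorem avg_ljSq_core {P σ e₁ e₂ e₃ : ℝ} (hP : 300 ≤ P) (hσ : 0 ≤ σ) (hσP : 289 * σ ≤ P) (he : e₁ + e₂ + e₃ = 0)
    (hB : e₁ ^ 2 + e₂ ^ 2 + e₃ ^ 2 ≤ 3 / 2 * σ * P) (h1 : e₁ ^ 2 ≤ P * σ) (h2 : e₂ ^ 2 ≤ P * σ) (h3 : e₃ ^ 2 ≤ P * σ) :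
    |(ljSq (P + (σ - 2 * e₁)) + ljSq (P + (σ - 2 * e₂)) + ljSq (P + (σ - 2 * e₃))) / 3 - ljSq P|
      ≤ 23 / 10 * σ * (P⁻¹) ^ 4 := by
  have hP0 : 0 < P := by linarith
  have h17 : 0 ≤ P / 17 := by positivity
  have hsq : (P / 17) ^ 2 = P * (P / 289) := by ring
  have hb : ∀ e : ℝ, e ^ 2 ≤ P * σ → 8 * |σ - 2 * e| ≤ P := by
    intro e he2
    have : |e| ≤ P / 17 := abs_le_of_sq_le_sq (by rw [hsq]; nlinarith) h17
    have h' : |σ - 2 * e| ≤ |σ| + 2 * |e| := by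
      calc |σ - 2 * e| ≤ |σ| + |2 * e| := abs_sub σ (2 * e)
        _ = |σ| + 2 * |e| := by rw [abs_mul, abs_two]
    rw [abs_of_nonneg hσ] at h'
    linarith
  obtain ⟨l1, u1⟩ := ljSq_sandwich hP0 (hb e₁ h1)
  obtain ⟨l2, u2⟩ := ljSq_sandwich hP0 (hb e₂ h2)
  obtain ⟨l3, u3⟩ := ljSq_sandwich hP0 (hb e₃ h3)
  set u : ℝ := P⁻¹ with hu
  have hu0 : 0 < u := inv_pos.2 hP0
  have hPu : P * u = 1 := mul_inv_cancel₀ hP0.ne'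
  set ε₁ : ℝ := σ - 2 * e₁ with hε₁
  set ε₂ : ℝ := σ - 2 * e₂ with hε₂
  set ε₃ : ℝ := σ - 2 * e₃ with hε₃
  -- sums of the displacements
  have s1 : ε₁ + ε₂ + ε₃ = 3 * σ := by rw [hε₁, hε₂, hε₃]; linarith
  have s2 : ε₁ ^ 2 + ε₂ ^ 2 + ε₃ ^ 2 = 3 * σ ^ 2 - 4 * σ * (e₁ + e₂ + e₃) + 4 * (e₁ ^ 2 + e₂ ^ 2 + e₃ ^ 2) := by
    rw [hε₁, hε₂, hε₃]; ring
  rw [he, mul_zero, sub_zero] at s2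
  have hE0 : 0 ≤ e₁ ^ 2 + e₂ ^ 2 + e₃ ^ 2 := by positivity
  -- scaled versions (`P·u = 1`)
  have s1a : (ε₁ + ε₂ + ε₃) * u ^ 4 = 3 * σ * u ^ 4 := by rw [s1]
  have s1b : (ε₁ + ε₂ + ε₃) * u ^ 7 = 3 * σ * u ^ 7 := by rw [s1]
  have s2a : (ε₁ ^ 2 + ε₂ ^ 2 + ε₃ ^ 2) * u ^ 5 ≤ 3 * σ ^ 2 * u ^ 5 + 6 * σ * u ^ 4 := by
    rw [s2]
    have := mul_le_mul_of_nonneg_right hB (pow_nonneg hu0.le 5)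
    have e : 3 / 2 * σ * P * u ^ 5 = 3 / 2 * σ * u ^ 4 * (P * u) := by ring
    rw [e, hPu, mul_one] at this
    linarith
  have s2a' : 3 * σ ^ 2 * u ^ 5 ≤ (ε₁ ^ 2 + ε₂ ^ 2 + ε₃ ^ 2) * u ^ 5 := by
    rw [s2]
    have : 0 ≤ (e₁ ^ 2 + e₂ ^ 2 + e₃ ^ 2) * u ^ 5 := mul_nonneg hE0 (pow_nonneg hu0.le 5)
    linarith
  have s2b : (ε₁ ^ 2 + ε₂ ^ 2 + ε₃ ^ 2) * u ^ 8 ≤ 3 * σ ^ 2 * u ^ 8 + 6 * σ * u ^ 7 := by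
    rw [s2]
    have := mul_le_mul_of_nonneg_right hB (pow_nonneg hu0.le 8)
    have e : 3 / 2 * σ * P * u ^ 8 = 3 / 2 * σ * u ^ 7 * (P * u) := by ring
    rw [e, hPu, mul_one] at this
    linarith
  have s2b' : 0 ≤ (ε₁ ^ 2 + ε₂ ^ 2 + ε₃ ^ 2) * u ^ 8 := by positivity
  -- small parameters: `σu ≤ 1/289`, `u³ ≤ 1/27000000`
  have hσu : σ * u ≤ 1 / 289 := by
    have := mul_le_mul_of_nonneg_right hσP hu0.le
    rw [hPu] at this
    linarith
  have hu3 : u ^ 3 ≤ 1 / 27000000 := by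
    have hu1 : u ≤ 1 / 300 := by
      rw [hu]; exact (inv_le_inv₀ hP0 (by norm_num)).2 hP |>.trans (by norm_num)
    calc u ^ 3 ≤ (1 / 300) ^ 3 := pow_le_pow_left₀ hu0.le hu1 3
      _ = 1 / 27000000 := by norm_num
  have f1 : σ ^ 2 * u ^ 5 ≤ 1 / 289 * (σ * u ^ 4) := by
    have := mul_le_mul_of_nonneg_right hσu (show 0 ≤ σ * u ^ 4 by positivity)
    calc σ ^ 2 * u ^ 5 = σ * u * (σ * u ^ 4) := by ring
      _ ≤ _ := this
  have f2 : σ * u ^ 7 ≤ 1 / 27000000 * (σ * u ^ 4) := by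
    have := mul_le_mul_of_nonneg_right hu3 (show 0 ≤ σ * u ^ 4 by positivity)
    calc σ * u ^ 7 = u ^ 3 * (σ * u ^ 4) := by ring
      _ ≤ _ := this
  have f3 : σ ^ 2 * u ^ 8 ≤ 1 / 289 * (σ * u ^ 4) := by
    have hu1 : u ^ 3 ≤ 1 := hu3.trans (by norm_num)
    have := mul_le_mul_of_nonneg_right hu1 (show 0 ≤ σ ^ 2 * u ^ 5 by positivity)
    calc σ ^ 2 * u ^ 8 = u ^ 3 * (σ ^ 2 * u ^ 5) := by ring
      _ ≤ 1 * (σ ^ 2 * u ^ 5) := this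
      _ ≤ _ := by rw [one_mul]; exact f1
  have f0 : 0 ≤ σ * u ^ 4 := by positivity
  have f0' : 0 ≤ σ ^ 2 * u ^ 5 := by positivity
  have f0'' : 0 ≤ σ * u ^ 7 := by positivity
  rw [abs_le]
  constructor <;> linarith [l1, l2, l3, u1, u2, u3, s1a, s1b, s2a, s2a', s2b, s2b', f1, f2, f3, f0, f0', f0'']

/-! ## §3. The 120°-frame: inner products against three slips summing to zero -/

/-- **Bessel for the slip frame**: `t₁ + t₂ + t₃ = 0`, `‖t_α‖² = σ` ⇒ `∑_α ⟨x, t_α⟩² ≤ (3/2)·σ·‖x‖²` (`= (3σ/2)|x_∥|²`). [folklore] -/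
theorem inner_sq_sum_le (x t₁ t₂ t₃ : E3) {σ : ℝ} (h0 : t₁ + t₂ + t₃ = 0) (h1 : ‖t₁‖ ^ 2 = σ) (h2 : ‖t₂‖ ^ 2 = σ)
    (h3 : ‖t₃‖ ^ 2 = σ) :
    inner ℝ x t₁ ^ 2 + inner ℝ x t₂ ^ 2 + inner ℝ x t₃ ^ 2 ≤ 3 / 2 * σ * ‖x‖ ^ 2 := by
  have ht3 : t₃ = -(t₁ + t₂) := eq_neg_of_add_eq_zero_right h0
  have h12 : inner ℝ t₁ t₂ = -(σ / 2) := by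
    have hn : ‖t₁ + t₂‖ ^ 2 = σ := by rw [← h3, ht3, norm_neg]
    rw [norm_add_sq_real, h1, h2] at hn
    linarith
  have he3 : inner ℝ x t₃ = -(inner ℝ x t₁ + inner ℝ x t₂) := by
    rw [ht3, inner_neg_right, inner_add_right]
  set a : ℝ := inner ℝ x t₁ with ha
  set b : ℝ := inner ℝ x t₂ with hb
  -- `0 ≤ ‖3σ•x − ((4a+2b)•t₁ + (2a+4b)•t₂)‖² = 9σ²‖x‖² − 12σ(a² + ab + b²)`
  have hσ : 0 ≤ σ := by rw [← h1]; positivity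
  have key : ‖(3 * σ) • x - (((4 * a + 2 * b) • t₁) + ((2 * a + 4 * b) • t₂))‖ ^ 2 =
      9 * σ ^ 2 * ‖x‖ ^ 2 - 12 * σ * (a ^ 2 + a * b + b ^ 2) := by
    rw [norm_sub_sq_real, norm_add_sq_real, norm_smul, norm_smul, norm_smul, inner_add_right, real_inner_smul_left,
      real_inner_smul_left, real_inner_smul_right, real_inner_smul_right, real_inner_smul_left, real_inner_smul_right,
      ← ha, ← hb, h12, mul_pow, mul_pow, mul_pow, Real.norm_eq_abs, Real.norm_eq_abs, Real.norm_eq_abs, sq_abs, sq_abs,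
      sq_abs, h1, h2]
    ring
  have hnn : 0 ≤ 9 * σ ^ 2 * ‖x‖ ^ 2 - 12 * σ * (a ^ 2 + a * b + b ^ 2) := by rw [← key]; positivity
  rw [he3]
  rcases hσ.eq_or_lt with hz | hpos
  · -- σ = 0: all slips vanish
    have z1 : t₁ = 0 := by rw [← norm_eq_zero]; nlinarith [norm_nonneg t₁, h1]
    have z2 : t₂ = 0 := by rw [← norm_eq_zero]; nlinarith [norm_nonneg t₂, h2]
    have : a = 0 := by rw [ha, z1, inner_zero_right]
    have : b = 0 := by rw [hb, z2, inner_zero_right]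
    subst hz; simp [*]
  · have : 12 * (a ^ 2 + a * b + b ^ 2) ≤ 9 * σ * ‖x‖ ^ 2 := by
      have h' : σ * (12 * (a ^ 2 + a * b + b ^ 2)) ≤ σ * (9 * σ * ‖x‖ ^ 2) := by nlinarith
      exact le_of_mul_le_mul_left h' hpos
    nlinarith

/-- ★ **THE α-AVERAGED FAR PAIR BOUND**: for a partner at relative position `x` with `‖x‖² ≥ 300` and three slips `t_α` with
`t₁ + t₂ + t₃ = 0`, `‖t_α‖² = σ`, `289σ ≤ ‖x‖²`:  `|⅓∑_α V(‖x − t_α‖) − V(‖x‖)| ≤ (23/10)·σ·‖x‖⁻⁸`  (first order cancels exactly;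
`V = lennardJones = r⁻¹²/12 − r⁻⁶/6`). [this file · kind: proof] -/
theorem avg_lennardJones_sub_le (x t₁ t₂ t₃ : E3) {σ : ℝ} (h0 : t₁ + t₂ + t₃ = 0) (h1 : ‖t₁‖ ^ 2 = σ) (h2 : ‖t₂‖ ^ 2 = σ)
    (h3 : ‖t₃‖ ^ 2 = σ) (hP : 300 ≤ ‖x‖ ^ 2) (hσP : 289 * σ ≤ ‖x‖ ^ 2) :
    |(lennardJones ‖x - t₁‖ + lennardJones ‖x - t₂‖ + lennardJones ‖x - t₃‖) / 3 - lennardJones ‖x‖|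
      ≤ 23 / 10 * σ * ((‖x‖ ^ 2)⁻¹) ^ 4 := by
  have hσ : 0 ≤ σ := by rw [← h1]; positivity
  have he : inner ℝ x t₁ + inner ℝ x t₂ + inner ℝ x t₃ = 0 := by
    rw [← inner_add_right, ← inner_add_right, h0, inner_zero_right]
  have hB := inner_sq_sum_le x t₁ t₂ t₃ h0 h1 h2 h3
  have hcs : ∀ t : E3, ‖t‖ ^ 2 = σ → inner ℝ x t ^ 2 ≤ ‖x‖ ^ 2 * σ := by
    intro t ht
    have := real_inner_mul_inner_self_le x t
    rw [real_inner_self_eq_norm_sq, real_inner_self_eq_norm_sq, ht] at this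
    nlinarith
  have d : ∀ t : E3, ‖t‖ ^ 2 = σ → ‖x - t‖ ^ 2 = ‖x‖ ^ 2 + (σ - 2 * inner ℝ x t) := by
    intro t ht; rw [norm_sub_sq_real, ht]; ring
  simp only [lennardJones_eq_ljSq, d t₁ h1, d t₂ h2, d t₃ h3]
  exact avg_ljSq_core hP hσ hσP he hB (hcs t₁ h1) (hcs t₂ h2) (hcs t₃ h3)

/-! ## §4. Summed over the far partners with the packing lemma of `…RunCutFarCone` -/

/-- ★ **THE FORGONE-LATTICE BOUND, SUMMED**: `a ≥ 4/5`, partners `T` pairwise `≥ a` apart and all `≥ 22a` from the mover `p`, three slips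
`t_α` with `∑ t_α = 0`, `‖t_α‖² = σ ≤ (3/2)a²`:  `∑_{q ∈ T} |⅓∑_α V(‖q − p − t_α‖) − V(‖q − p‖)| ≤ (23/10)·σ·((38/5)·a⁻⁸·22⁻⁵)`.
[this file · kind: proof] -/
theorem forgone_far_sum_le (T : Finset E3) {a : ℝ} (ha : 4 / 5 ≤ a) (p : E3)
    (hsep : ∀ q ∈ T, ∀ q' ∈ T, q ≠ q' → a ≤ dist q q') (hfar : ∀ q ∈ T, 22 * a ≤ dist q p)
    (t₁ t₂ t₃ : E3) {σ : ℝ} (h0 : t₁ + t₂ + t₃ = 0) (h1 : ‖t₁‖ ^ 2 = σ) (h2 : ‖t₂‖ ^ 2 = σ) (h3 : ‖t₃‖ ^ 2 = σ)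
    (hσa : σ ≤ 3 / 2 * a ^ 2) :
    ∑ q ∈ T, |(lennardJones ‖q - p - t₁‖ + lennardJones ‖q - p - t₂‖ + lennardJones ‖q - p - t₃‖) / 3 - lennardJones ‖q - p‖|
      ≤ 23 / 10 * σ * (38 / 5 * (a⁻¹) ^ 8 * ((22 : ℝ)⁻¹) ^ 5) := by
  have ha0 : 0 < a := by linarith
  have hσ : 0 ≤ σ := by rw [← h1]; positivity
  have hq : ∀ q ∈ T, |(lennardJones ‖q - p - t₁‖ + lennardJones ‖q - p - t₂‖ + lennardJones ‖q - p - t₃‖) / 3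
      - lennardJones ‖q - p‖| ≤ 23 / 10 * σ * ((dist q p)⁻¹) ^ 8 := by
    intro q hqT
    have hd : 22 * a ≤ ‖q - p‖ := by rw [← dist_eq_norm]; exact hfar q hqT
    have h22 : 0 ≤ 22 * a := by positivity
    have hP : 300 ≤ ‖q - p‖ ^ 2 := by nlinarith [mul_le_mul hd hd h22 (norm_nonneg _)]
    have hσP : 289 * σ ≤ ‖q - p‖ ^ 2 := by nlinarith [mul_le_mul hd hd h22 (norm_nonneg _)]
    have h := avg_lennardJones_sub_le (q - p) t₁ t₂ t₃ h0 h1 h2 h3 hP hσP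
    have e8 : ((‖q - p‖ ^ 2)⁻¹) ^ 4 = ((dist q p)⁻¹) ^ 8 := by rw [dist_eq_norm, ← inv_pow, ← pow_mul]
    rw [e8] at h
    exact h
  have key : ∑ q ∈ T, ((dist q p)⁻¹) ^ 8 ≤ 38 / 5 * (a⁻¹) ^ 8 * ((22 : ℝ)⁻¹) ^ 5 := by
    have h := OverbindingBudgetAffineRunCutFarCone.sum_inv_pow_eight_far_le_of_le_21 T ha0 p hsep (n₀ := 22) (by norm_num)
    rw [filter_true_of_mem (fun q hqT => by exact_mod_cast hfar q hqT)] at h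
    exact_mod_cast h
  calc _ ≤ ∑ q ∈ T, 23 / 10 * σ * ((dist q p)⁻¹) ^ 8 := sum_le_sum hq
    _ = 23 / 10 * σ * ∑ q ∈ T, ((dist q p)⁻¹) ^ 8 := by rw [mul_sum]
    _ ≤ 23 / 10 * σ * (38 / 5 * (a⁻¹) ^ 8 * ((22 : ℝ)⁻¹) ^ 5) := mul_le_mul_of_nonneg_left key (by positivity)

end Summit.AtomisticToContinuum.Crystallization.Theorems.OverbindingBudgetAffineRunCutForgone

end
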